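import Summits.MatrixMultiplication.MatrixMultiplication.Theorems.TetrahedronTensorRectangular
import HarnessLib

/-!
# Tetrahedron tensor — what `TetraFlat` gives for `ω` on its own: `ω ≤ 12/5`

The attacked conjunct `TetraFlat : ω(K₄) ≤ 4` of the tetrahedron carving (decomp-mm lens 6, g13)
yields `ω(2,1,2) = ω(1,2,2) = ω(2,2,1) = 4` (`TetrahedronTensorRectangular.lean`), hence by the
Lotti–Romani subadditivity `ω(5,5,5) ≤ ω(1,2,2) + ω(2,1,2) + ω(2,2,1) = 12` and homogeneity
`ω(5,5,5) = 5ω`:  **`ω(K₄) ≤ 4 → ω ≤ 12/5`** (`omega_le_twelve_fifths_of_omegaTetra_le_four`).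
This is the precise sense of the tag «WEAKER» on `TetraFlat`: alone it is only known to give
`ω ≤ 2.4` (above the record `2.371339`), not `ω = 2`. Sorry-free.
-/

noncomputable section

set_option linter.dupNamespace false

namespace Summit.MatrixMultiplication.MatrixMultiplication.Theorems.TetrahedronTensor

open Literature.Computability.AlgebraicComplexity

variable (F : Type) [Field F]

/-- `ω(K₄) ≤ 4 → ω(2,2,1) = 4`. [folklore] -/
theorem omegaRect_two_two_one_eq_four_of_omegaTetra_le_four (h : omegaTetra F ≤ 4) :
    omegaRect F 2 2 1 = 4 := by
  rw [← omegaRect_swap₂₃ F 2 1 2]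
  exact omegaRect_two_one_two_eq_four_of_omegaTetra_le_four F h

/-- **`TetraFlat` alone: `ω(K₄) ≤ 4 → ω ≤ 12/5`** (the cyclic product
`⟨n,n²,n²⟩ ⊗ ⟨n²,n,n²⟩ ⊗ ⟨n²,n²,n⟩ = ⟨n⁵,n⁵,n⁵⟩`, in exponent form: Lotti–Romani subadditivity and
homogeneity). [cite: LottiRomani1983, §1 (p. 173)] -/
theorem omega_le_twelve_fifths_of_omegaTetra_le_four (h : omegaTetra F ≤ 4) :
    omega F ≤ 12 / 5 := by
  have h212 := omegaRect_two_one_two_eq_four_of_omegaTetra_le_four F h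
  have h122 := omegaRect_one_two_two_eq_four_of_omegaTetra_le_four F h
  have h221 := omegaRect_two_two_one_eq_four_of_omegaTetra_le_four F h
  have hsub1 := LottiRomani1983_subadditive F 1 2 2 2 1 2
  have hsub2 := LottiRomani1983_subadditive F (1 + 2) (2 + 1) (2 + 2) 2 2 1
  have hhom := LottiRomani1983_homogeneous F (ν := 5) (x := 1) (y := 1) (z := 1)
    (by norm_num) (by norm_num) (by norm_num) (by norm_num)
  rw [omegaRect_one_one_one] at hhom
  have e5 : omegaRect F (1 + 2 + 2) (2 + 1 + 2) (2 + 2 + 1) = omegaRect F (5 * 1) (5 * 1) (5 * 1) := by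
    norm_num
  linarith

/-- The bracket of consequences of `TetraFlat` alone: `½ ≤ α` and `ω ≤ 12/5`. [folklore] -/
theorem tetraFlat_consequences (h : omegaTetra F ≤ 4) :
    1 / 2 ≤ dualExponentAlpha F ∧ omega F ≤ 12 / 5 :=
  ⟨half_le_dualExponentAlpha_of_omegaTetra_le_four F h,
    omega_le_twelve_fifths_of_omegaTetra_le_four F h⟩

end Summit.MatrixMultiplication.MatrixMultiplication.Theorems.TetrahedronTensor

end
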